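import Summits.KontsevichZagierPeriods.KontsevichZagierPeriods.Theorems.SoloInformedAlgVertexInduction
import Mathlib.Algebra.Polynomial.Degree.TrailingDegree
import HarnessLib

/-!
# The sign-configuration calculus over `K`: the curve measure `μ♯`

Solo programme `solo-KontsevichZagierPeriods-informed`, session s111, step (γ-1) of PRES-RAT(2)
(presentability of rational integrands on semialgebraic plane domains): the **termination measure
for curve germs**.  THEOREM VG (`SoloInformedAlgVertexInduction`) resolved an *isolated zero* of
`F ∈ K[x₀, x₁]` by blow-ups, with the measure `μ(F) = (mult, ν)`, `ν = (ord₀ F(x, φ x), ord₀ φ)` along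
the maximal-contact curve `φ`.  For a *curve* germ (the boundary curve of a sign configuration) the
second component of `ν` is useless — `F` may vanish identically along `φ` while `ord₀ φ` grows under
a blow-up (e.g. `(x₁ − θx₀)((x₁ − θx₀)² + x₀⁴)`).  We replace it:

* `soloInformedNuCK F = ν♯(F) = (ord₀ F(x, φ x), ord₀ (∂₁F)(x, φ x))` (lexicographic, in `ℕ∞ ×ₗ ℕ∞`),
  with **branch independence** `soloInformed_nuCK_eq_of_branch` and the existence of the contact
  curve `soloInformed_exists_contactCurveC` (from `SoloInformedAnNu`);
* `soloInformedKappaK F = κ″(F) = ord₀ F(t, 0) + ord₀ F(0, t) ∈ ℕ∞` — the **edge-contact number**, the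
  measure of a smooth germ (`mult = 1`) at a corner, symmetric under the swap;
* `soloInformedMuCK F = μ♯(F) = (mult F, (κ″, 0) if mult ≤ 1 | ν♯(F) | ν♯(swap F) | ⊥)` in the
  well-ordered type `ℕ ×ₗ (ℕ∞ ×ₗ ℕ∞)`, with the comparison lemmas of THEOREM VG and
  `soloInformed_muCK_eq_muCK_swapK` (the swapped pure case has the measure of its swap).

The drop lemmas for `μ♯` along a blow-up are the next file.

References: J. Kollár, *Lectures on Resolution of Singularities* (2007), §1.10 (maximal contact);
M. Kontsevich, D. Zagier, *Periods* (2001), §1.2.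
-/

noncomputable section

open scoped BigOperators Topology ContDiff
open Filter Polynomial Set

namespace Summit.KontsevichZagierPeriods.KontsevichZagierPeriods.Theorems

variable {K : Type*} [Field K] [Algebra K ℝ]

/-! ### The curve measure `ν♯` -/

open Classical in
/-- **The curve measure** `ν♯(F) = (ord₀ F(x, φ x), ord₀ (∂₁ F)(x, φ x))` along the maximal-contact
curve `φ` of `F` (and `(0, 0)` if there is none). [this work] -/
def soloInformedNuCK (F : MvPolynomial (Fin 2) K) : ℕ∞ ×ₗ ℕ∞ :=
  if H : SoloInformedContactOK F then
    toLex (analyticOrderAt (fun x => soloInformedEvalR F (x, soloInformedContactCurveK F H x)) 0,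
      analyticOrderAt (fun x => soloInformedEvalR (MvPolynomial.pderiv 1 F)
        (x, soloInformedContactCurveK F H x)) 0)
  else toLex (0, 0)

/-- **Branch independence of `ν♯`.**  If the maximal-contact polynomial `h` vanishes at `0` and
`ψ` is a continuous branch of `h = 0` through the origin, then
`ν♯(F) = (ord₀ F(x, ψ x), ord₀ (∂₁F)(x, ψ x))`. [this work] -/
theorem soloInformed_nuCK_eq_of_branch {F : MvPolynomial (Fin 2) K} (H : SoloInformedContactOK F)
    (h0 : soloInformedEvalR (soloInformedMaxContactK F) ((0 : ℝ), (0 : ℝ)) = 0) {ψ : ℝ → ℝ}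
    (hψ0 : ψ 0 = 0) (hψc : ContinuousAt ψ 0)
    (hψ : ∀ᶠ x in 𝓝 0, soloInformedEvalR (soloInformedMaxContactK F) (x, ψ x) = 0) :
    soloInformedNuCK F =
      toLex (analyticOrderAt (fun x => soloInformedEvalR F (x, ψ x)) 0,
        analyticOrderAt (fun x => soloInformedEvalR (MvPolynomial.pderiv 1 F) (x, ψ x)) 0) := by
  unfold soloInformedNuCK
  rw [dif_pos H]
  set φ := soloInformedContactCurveK F H with hφ
  have huniq := (soloInformed_contDiffAt_maxContactK F).eventually_apply_eq_iff_implicitFunction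
    Literature.Analysis.Calculus.omega_ne_zero H
  have htend : Tendsto (fun x : ℝ => (x, ψ x)) (𝓝 0) (𝓝 ((0 : ℝ), (0 : ℝ))) := by
    have h := (continuous_id.continuousAt (x := (0 : ℝ))).prodMk hψc
    rwa [ContinuousAt, id, hψ0] at h
  have hev : ∀ᶠ x in 𝓝 (0 : ℝ), φ x = ψ x := by
    filter_upwards [htend.eventually huniq, hψ] with x hx hx'
    rw [h0] at hx
    exact hx.1 hx'
  have h1 : analyticOrderAt (fun x => soloInformedEvalR F (x, φ x)) 0 =
      analyticOrderAt (fun x => soloInformedEvalR F (x, ψ x)) 0 :=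
    analyticOrderAt_congr (hev.mono fun x hx => by simp only [hx])
  have h2 : analyticOrderAt (fun x => soloInformedEvalR (MvPolynomial.pderiv 1 F) (x, φ x)) 0 =
      analyticOrderAt (fun x => soloInformedEvalR (MvPolynomial.pderiv 1 F) (x, ψ x)) 0 :=
    analyticOrderAt_congr (hev.mono fun x hx => by simp only [hx])
  rw [h1, h2]

/-- **The maximal-contact curve computes `ν♯`**: an analytic branch `φ` of `h = 0` through the
origin, with `∂₀h(0) + φ'(0) ∂₁h(0) = 0`, along which `ν♯(F)` is read. [this work] -/
theorem soloInformed_exists_contactCurveC {F : MvPolynomial (Fin 2) K}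
    (H : SoloInformedContactOK F)
    (h0 : soloInformedEvalR (soloInformedMaxContactK F) ((0 : ℝ), (0 : ℝ)) = 0) :
    ∃ φ : ℝ → ℝ, AnalyticAt ℝ φ 0 ∧ φ 0 = 0 ∧
      (∀ᶠ x in 𝓝 0, soloInformedEvalR (soloInformedMaxContactK F) (x, φ x) = 0) ∧
      algebraMap K ℝ (MvPolynomial.coeff (Finsupp.single 0 1) (soloInformedMaxContactK F)) +
        deriv φ 0 * algebraMap K ℝ
          (MvPolynomial.coeff (Finsupp.single 1 1) (soloInformedMaxContactK F)) = 0 ∧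
      soloInformedNuCK F =
        toLex (analyticOrderAt (fun x => soloInformedEvalR F (x, φ x)) 0,
          analyticOrderAt (fun x => soloInformedEvalR (MvPolynomial.pderiv 1 F) (x, φ x)) 0) := by
  obtain ⟨φ, han, hφ0, hev, hder, -⟩ := soloInformed_exists_contactCurve H h0
  exact ⟨φ, han, hφ0, hev, hder, soloInformed_nuCK_eq_of_branch H h0 hφ0 han.continuousAt hev⟩

/-- Without the contact condition `ν♯ = (0, 0)`. [this work] -/
theorem soloInformed_nuCK_of_not_contactOK {F : MvPolynomial (Fin 2) K}
    (H : ¬ SoloInformedContactOK F) : soloInformedNuCK F = toLex (0, 0) := by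
  unfold soloInformedNuCK
  rw [dif_neg H]

/-! ### The edge-contact number `κ″` -/

/-- **The edge-contact number** `κ″(F) = ord₀ F(t, 0) + ord₀ F(0, t)`: the orders of vanishing at
`0` of the two axis polynomials of `F` (`⊤` if `F` vanishes identically on an axis). [this work] -/
def soloInformedKappaK (F : MvPolynomial (Fin 2) K) : ℕ∞ :=
  (soloInformedEdgePolyK 0 F).trailingDegree + (soloInformedEdgePolyK 1 F).trailingDegree

omit [Algebra K ℝ] in
/-- The axis polynomials of the swap are the swapped axis polynomials. [this work] -/
theorem soloInformed_edgePolyK_zero_swapK (F : MvPolynomial (Fin 2) K) :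
    soloInformedEdgePolyK 0 (soloInformedSwapK F) = soloInformedEdgePolyK 1 F := by
  ext k
  rw [soloInformed_coeff_edgePolyK, soloInformed_coeff_edgePolyK]
  have h := soloInformed_coeff_swapK F k 0
  simpa only [Finsupp.single_zero, add_zero, zero_add] using h

omit [Algebra K ℝ] in
/-- The axis polynomials of the swap are the swapped axis polynomials. [this work] -/
theorem soloInformed_edgePolyK_one_swapK (F : MvPolynomial (Fin 2) K) :
    soloInformedEdgePolyK 1 (soloInformedSwapK F) = soloInformedEdgePolyK 0 F := by
  conv_rhs => rw [← soloInformed_swapK_swapK F]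
  rw [soloInformed_edgePolyK_zero_swapK]

omit [Algebra K ℝ] in
/-- `κ″` is symmetric under the swap. [this work] -/
theorem soloInformed_kappaK_swapK (F : MvPolynomial (Fin 2) K) :
    soloInformedKappaK (soloInformedSwapK F) = soloInformedKappaK F := by
  unfold soloInformedKappaK
  rw [soloInformed_edgePolyK_zero_swapK, soloInformed_edgePolyK_one_swapK, add_comm]

omit [Algebra K ℝ] in
/-- `κ″` is finite iff `F` vanishes identically on neither axis. [this work] -/
theorem soloInformed_kappaK_lt_top_iff (F : MvPolynomial (Fin 2) K) :
    soloInformedKappaK F < ⊤ ↔ soloInformedEdgePolyK 0 F ≠ 0 ∧ soloInformedEdgePolyK 1 F ≠ 0 := by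
  unfold soloInformedKappaK
  rw [lt_top_iff_ne_top, Ne, ENat.add_eq_top, not_or, Polynomial.trailingDegree_eq_top,
    Polynomial.trailingDegree_eq_top]

omit [Algebra K ℝ] in
/-- **Reading off a trailing degree**: if `coeff k p = 0` for `k < n` and `coeff n p ≠ 0` then
`trailingDegree p = n`. [this work] -/
theorem soloInformed_trailingDegree_eq_of_coeff {p : Polynomial K} {n : ℕ}
    (hlt : ∀ k < n, p.coeff k = 0) (hn : p.coeff n ≠ 0) : p.trailingDegree = n := by
  refine le_antisymm (Polynomial.trailingDegree_le_of_ne_zero hn) ?_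
  have hp : p ≠ 0 := fun h => hn (by rw [h, Polynomial.coeff_zero])
  rw [Polynomial.trailingDegree_eq_natTrailingDegree hp]
  exact_mod_cast Polynomial.le_natTrailingDegree hp hlt

omit [Algebra K ℝ] in
/-- **Shifting a trailing degree**: if `q.coeff k = u k * p.coeff (k + 1)` with all `u k ≠ 0` and
`p.coeff 0 = 0`, then `trailingDegree q + 1 = trailingDegree p`. [this work] -/
theorem soloInformed_trailingDegree_shift {p q : Polynomial K} {u : ℕ → K} (hu : ∀ k, u k ≠ 0)
    (hq : ∀ k, q.coeff k = u k * p.coeff (k + 1)) (hp0 : p.coeff 0 = 0) :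
    q.trailingDegree + 1 = p.trailingDegree := by
  by_cases hp : p = 0
  · have hq0 : q = 0 := by
      ext k; rw [hq k, hp, Polynomial.coeff_zero, Polynomial.coeff_zero, mul_zero]
    rw [hp, hq0, Polynomial.trailingDegree_zero, top_add]
  · set n := p.natTrailingDegree with hn
    have hpn : p.coeff n ≠ 0 := by
      rw [hn]; exact Polynomial.trailingCoeff_nonzero_iff_nonzero.2 hp
    have hn0 : n ≠ 0 := fun h => hpn (by rw [h]; exact hp0)
    have hlt : ∀ k < n, p.coeff k = 0 := fun k hk =>
      Polynomial.coeff_eq_zero_of_lt_natTrailingDegree hk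
    obtain ⟨n', hn'⟩ := Nat.exists_eq_succ_of_ne_zero hn0
    have hqn : q.trailingDegree = n' := by
      refine soloInformed_trailingDegree_eq_of_coeff (fun k hk => ?_) ?_
      · rw [hq k, hlt (k + 1) (by omega), mul_zero]
      · rw [hq n', ← Nat.succ_eq_add_one, ← hn']; exact mul_ne_zero (hu n') hpn
    rw [hqn, Polynomial.trailingDegree_eq_natTrailingDegree hp, ← hn, hn']
    rfl

/-! ### The termination measure `μ♯` -/

open Classical in
/-- **The curve termination measure**
`μ♯(F) = (mult F, (κ″(F), 0) if mult F ≤ 1 | ν♯(F) | ν♯(swap F) | ⊥)`. [this work] -/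
def soloInformedMuCK (F : MvPolynomial (Fin 2) K) : ℕ ×ₗ (ℕ∞ ×ₗ ℕ∞) :=
  toLex (soloInformedMultK F,
    if soloInformedMultK F ≤ 1 then toLex (soloInformedKappaK F, 0)
    else if soloInformedTopCoeffK F ≠ 0 then soloInformedNuCK F
    else if soloInformedTopCoeffK (soloInformedSwapK F) ≠ 0 then soloInformedNuCK (soloInformedSwapK F)
    else toLex (0, 0))

/-- The measure of a germ of multiplicity `≤ 1`. [this work] -/
theorem soloInformed_muCK_eq_of_multK_le_one {F : MvPolynomial (Fin 2) K}
    (h : soloInformedMultK F ≤ 1) :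
    soloInformedMuCK F = toLex (soloInformedMultK F, toLex (soloInformedKappaK F, 0)) := by
  unfold soloInformedMuCK
  rw [if_pos h]

/-- The measure when the multiplicity is `≥ 2` and the pure `x₁^m` coefficient is non-zero.
[this work] -/
theorem soloInformed_muCK_eq_of_topCoeff_ne {F : MvPolynomial (Fin 2) K}
    (hm : ¬ soloInformedMultK F ≤ 1) (h : soloInformedTopCoeffK F ≠ 0) :
    soloInformedMuCK F = toLex (soloInformedMultK F, soloInformedNuCK F) := by
  unfold soloInformedMuCK
  rw [if_neg hm, if_pos h]

/-- The measure when the multiplicity is `≥ 2` and only the swapped pure coefficient is non-zero.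
[this work] -/
theorem soloInformed_muCK_eq_of_topCoeff_swapK_ne {F : MvPolynomial (Fin 2) K}
    (hm : ¬ soloInformedMultK F ≤ 1) (h0 : soloInformedTopCoeffK F = 0)
    (h1 : soloInformedTopCoeffK (soloInformedSwapK F) ≠ 0) :
    soloInformedMuCK F = toLex (soloInformedMultK F, soloInformedNuCK (soloInformedSwapK F)) := by
  unfold soloInformedMuCK
  rw [if_neg hm, if_neg (not_not.2 h0), if_pos h1]

/-- A smaller multiplicity gives a smaller measure. [this work] -/
theorem soloInformed_muCK_lt_of_multK_lt {G F : MvPolynomial (Fin 2) K}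
    (h : soloInformedMultK G < soloInformedMultK F) : soloInformedMuCK G < soloInformedMuCK F := by
  unfold soloInformedMuCK
  rw [Prod.Lex.toLex_lt_toLex]
  exact Or.inl h

/-- Germs of the same multiplicity `≤ 1` compare by `κ″`. [this work] -/
theorem soloInformed_muCK_lt_of_kappaK_lt {G F : MvPolynomial (Fin 2) K}
    (hm : soloInformedMultK G = soloInformedMultK F) (h1 : soloInformedMultK F ≤ 1)
    (h : soloInformedKappaK G < soloInformedKappaK F) : soloInformedMuCK G < soloInformedMuCK F := by
  rw [soloInformed_muCK_eq_of_multK_le_one h1, soloInformed_muCK_eq_of_multK_le_one (hm ▸ h1), hm,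
    Prod.Lex.toLex_lt_toLex]
  exact Or.inr ⟨rfl, Prod.Lex.toLex_lt_toLex.2 (Or.inl h)⟩

/-- Germs of the same multiplicity `≥ 2` with non-zero pure coefficients compare by `ν♯`.
[this work] -/
theorem soloInformed_muCK_lt_of_nuCK_lt {G F : MvPolynomial (Fin 2) K}
    (hm : soloInformedMultK G = soloInformedMultK F) (h1 : ¬ soloInformedMultK F ≤ 1)
    (hG : soloInformedTopCoeffK G ≠ 0) (hF : soloInformedTopCoeffK F ≠ 0)
    (h : soloInformedNuCK G < soloInformedNuCK F) : soloInformedMuCK G < soloInformedMuCK F := by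
  rw [soloInformed_muCK_eq_of_topCoeff_ne h1 hF, soloInformed_muCK_eq_of_topCoeff_ne (hm ▸ h1) hG,
    hm, Prod.Lex.toLex_lt_toLex]
  exact Or.inr ⟨rfl, h⟩

/-! ### The swapped pure case -/

/-- **The swapped pure case has the measure of its swap.**  If `cone_F` is not a pure power with
non-negative root but `cone_{swap F} = c (X − θ)^m` (`c ≠ 0`, `θ ≥ 0`), then `μ♯(F) = μ♯(swap F)`.
[this work] -/
theorem soloInformed_muCK_eq_muCK_swapK {F : MvPolynomial (Fin 2) K} {k : ℕ}
    (hmult : soloInformedMultK F = k + 1)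
    (h₁ : ∀ c t : K, c ≠ 0 → 0 ≤ algebraMap K ℝ t →
      soloInformedConePolyK F (k + 1) ≠ C c * (X - C t) ^ (k + 1))
    {c θ : K} (hc : c ≠ 0) (hθ : 0 ≤ algebraMap K ℝ θ)
    (hcone : soloInformedConePolyK (soloInformedSwapK F) (k + 1) = C c * (X - C θ) ^ (k + 1)) :
    soloInformedMuCK F = soloInformedMuCK (soloInformedSwapK F) := by
  have hm := soloInformed_le_deg_of_multK_eq hmult
  have hm₂ := soloInformed_le_deg_swapK hm
  have hmult₂ : soloInformedMultK (soloInformedSwapK F) = k + 1 := by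
    rw [soloInformed_multK_swapK, hmult]
  by_cases hk : k + 1 ≤ 1
  · -- multiplicity `1`: the measure is `κ″`, symmetric under the swap
    rw [soloInformed_muCK_eq_of_multK_le_one (hmult ▸ hk),
      soloInformed_muCK_eq_of_multK_le_one (hmult₂ ▸ hk), hmult, hmult₂, soloInformed_kappaK_swapK]
  -- `cone_F` is the reflection of `cone_{swap F}`
  have hrefl : soloInformedConePolyK F (k + 1) = (C c * (X - C θ) ^ (k + 1)).reflect (k + 1) := by
    rw [← hcone, ← soloInformed_conePolyK_swapK _ hm₂, soloInformed_swapK_swapK]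
  -- `θ = 0`
  have hθ0 : θ = 0 := by
    by_contra hne
    refine h₁ (c * (-θ) ^ (k + 1)) θ⁻¹ (mul_ne_zero hc (pow_ne_zero _ (neg_ne_zero.2 hne))) ?_ ?_
    · rw [map_inv₀]; exact inv_nonneg.2 hθ
    · rw [hrefl, soloInformed_reflect_pureCone c hne]
  rw [hθ0, map_zero, sub_zero] at hcone hrefl
  have htopF : soloInformedTopCoeffK F = 0 := by
    unfold soloInformedTopCoeffK
    rw [hmult, ← soloInformed_coeff_conePolyK_self F hm, hrefl, Polynomial.reflect_C_mul_X_pow,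
      Polynomial.revAt_le le_rfl, Nat.sub_self, pow_zero, mul_one, Polynomial.coeff_C,
      if_neg (Nat.succ_ne_zero k)]
  have htopS : soloInformedTopCoeffK (soloInformedSwapK F) ≠ 0 := by
    unfold soloInformedTopCoeffK
    rw [hmult₂, ← soloInformed_coeff_conePolyK_self _ hm₂, hcone, Polynomial.coeff_C_mul_X_pow,
      if_pos rfl]
    exact hc
  rw [soloInformed_muCK_eq_of_topCoeff_swapK_ne (hmult ▸ hk) htopF htopS,
    soloInformed_muCK_eq_of_topCoeff_ne (hmult₂ ▸ hk) htopS, hmult, hmult₂]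

/-! ### Multiplicity one: the cone and `κ″` -/

omit [Algebra K ℝ] in
/-- For a germ of multiplicity `1` the cone polynomial is `a₀ + a₁ X` with `a₀, a₁` the linear
coefficients. [this work] -/
theorem soloInformed_conePolyK_of_multK_one {F : MvPolynomial (Fin 2) K}
    (h : soloInformedMultK F = 1) :
    soloInformedConePolyK F 1 = C (MvPolynomial.coeff (Finsupp.single 0 1) F) +
      C (MvPolynomial.coeff (Finsupp.single 1 1) F) * X := by
  have hm := soloInformed_le_deg_of_multK_eq h
  ext k
  rw [soloInformed_coeff_conePolyK F hm, Polynomial.coeff_add, Polynomial.coeff_C,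
    Polynomial.coeff_C_mul_X]
  rcases Nat.lt_or_ge k 2 with hk | hk
  · interval_cases k
    · simp
    · simp
  · rw [if_neg (by omega), if_neg (by omega), if_neg (by omega), add_zero]

omit [Algebra K ℝ] in
/-- For a germ of multiplicity `1` with vanishing `x₀`-coefficient (tangent to the `x₀`-axis):
`ord₀ F(0, t) = 1`. [this work] -/
theorem soloInformed_trailingDegree_edgePolyK_one_of_multK_one {F : MvPolynomial (Fin 2) K}
    (h : soloInformedMultK F = 1) (h1 : MvPolynomial.coeff (Finsupp.single 1 1) F ≠ 0) :
    (soloInformedEdgePolyK 1 F).trailingDegree = 1 := by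
  have hm := soloInformed_le_deg_of_multK_eq h
  refine soloInformed_trailingDegree_eq_of_coeff (fun k hk => ?_) ?_
  · have hk0 : k = 0 := by omega
    rw [hk0, soloInformed_coeff_edgePolyK, Finsupp.single_zero]
    by_contra hne
    have := hm 0 (MvPolynomial.mem_support_iff.2 hne)
    simp at this
  · rw [soloInformed_coeff_edgePolyK]; exact h1

omit [Algebra K ℝ] in
/-- The constant coefficient of an axis polynomial of a germ of positive multiplicity vanishes.
[this work] -/
theorem soloInformed_coeff_zero_edgePolyK_of_multK {F : MvPolynomial (Fin 2) K} {k : ℕ}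
    (h : soloInformedMultK F = k + 1) (i : Fin 2) : (soloInformedEdgePolyK i F).coeff 0 = 0 := by
  rw [soloInformed_coeff_edgePolyK, Finsupp.single_zero]
  by_contra hne
  have := soloInformed_le_deg_of_multK_eq h 0 (MvPolynomial.mem_support_iff.2 hne)
  simp at this

end Summit.KontsevichZagierPeriods.KontsevichZagierPeriods.Theorems
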